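import Summits.Ventures.HodgeRepro.FaceCensusRows8Proof
import Summits.Ventures.HodgeRepro.Night3CensusBridge

/-!
# The sealed census rows of degree 6 and 8 cover their faces up to Galois twist (kernel)

Blind re-derivation cell `pub-hodge-repro`, seat `night-3` (gen 3).  Imports p4's `FaceCensusRows8Proof` (the sealed
order-6 / order-8 rows `FaceCensusRows8` with their `census` theorems, whose first clause is the group check) and
night-3's `Night3CensusBridge` (`coversFaces`, the transport `cover_of_coversFaces`).  Namespace
`HodgeRepro.Night3.Census`.

For each of the seven sealed rows of order `6` and `8`, `coversFaces Γ reps = true` is decided on the kernel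
(`decide +kernel`; the sealed `reps` are the row's displayed representatives), and the transport reads it in the model:
every face `(Φ; p, p')` of `(Elt Γ, conj Γ)` has a corner multiset which is a right twist of the corner multiset of one
of the sealed representatives.  This is the hypothesis `hcover` of night-3's twist reduction (`alg_of_faces_gset_reps`):
S4 on the sealed representatives' corner products (+ Lefschetz (1,1) on the pairs, Lemma P, twist invariance) ⟹ S4 for
every corner product of that Galois CM type.  Nothing here closes S4; no sealed file is touched; no Tier-2 item depends
on this file.
-/

set_option autoImplicit false

namespace HodgeRepro.Night3.Census

open Summit.Ventures.HodgeRepro.FaceCensus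
open HodgeRepro.EngineBridge

/-! ### Row `Sextic.Cyclic` — the cyclic sextic row (degree 6; 1 representative) -/

/-- The group check of the row, from p4's census theorem. -/
instance factSexticCyclic : Fact (Sextic.Cyclic.Γ.isCMGaloisType = true) := ⟨Sextic.Cyclic.census.1⟩

/-- The cover check of the row `Sextic.Cyclic` (kernel computation). -/
theorem coversFaces_sexticCyclic : coversFaces Sextic.Cyclic.Γ Sextic.Cyclic.reps = true := by decide +kernel

/-- **Row `Sextic.Cyclic`**: every face of the model is a twist of a sealed representative. -/
theorem cover_sexticCyclic (Φ : Finset (Elt Sextic.Cyclic.Γ)) (p p' : Elt Sextic.Cyclic.Γ)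
    (hΦ : IsCMType (Elt.conj Sextic.Cyclic.Γ) Φ) (hp : p' ∉ place (Elt.conj Sextic.Cyclic.Γ) p) :
    ∃ r ∈ Sextic.Cyclic.reps, ∃ g : Elt Sextic.Cyclic.Γ,
      GSet.faceCornersMul (Elt.conj Sextic.Cyclic.Γ) Φ p p' = (cornersMul Sextic.Cyclic.Γ r).map fun S => rmul S g :=
  cover_of_coversFaces Sextic.Cyclic.Γ Sextic.Cyclic.reps coversFaces_sexticCyclic Φ p p' hΦ hp

/-! ### Row `Octic.Cyclic` — the cyclic octic row (3 representatives) -/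

/-- The group check of the row, from p4's census theorem. -/
instance factOcticCyclic : Fact (Octic.Cyclic.Γ.isCMGaloisType = true) := ⟨Octic.Cyclic.census.1⟩

/-- The cover check of the row `Octic.Cyclic` (kernel computation). -/
theorem coversFaces_octicCyclic : coversFaces Octic.Cyclic.Γ Octic.Cyclic.reps = true := by decide +kernel

/-- **Row `Octic.Cyclic`**: every face of the model is a twist of a sealed representative. -/
theorem cover_octicCyclic (Φ : Finset (Elt Octic.Cyclic.Γ)) (p p' : Elt Octic.Cyclic.Γ)
    (hΦ : IsCMType (Elt.conj Octic.Cyclic.Γ) Φ) (hp : p' ∉ place (Elt.conj Octic.Cyclic.Γ) p) :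
    ∃ r ∈ Octic.Cyclic.reps, ∃ g : Elt Octic.Cyclic.Γ,
      GSet.faceCornersMul (Elt.conj Octic.Cyclic.Γ) Φ p p' = (cornersMul Octic.Cyclic.Γ r).map fun S => rmul S g :=
  cover_of_coversFaces Octic.Cyclic.Γ Octic.Cyclic.reps coversFaces_octicCyclic Φ p p' hΦ hp

/-! ### Row `Octic.C4C2Square` — the row `ℤ/4 × ℤ/2`, `c` a square (4 representatives) -/

/-- The group check of the row, from p4's census theorem. -/
instance factOcticC4C2Square : Fact (Octic.C4C2Square.Γ.isCMGaloisType = true) := ⟨Octic.C4C2Square.census.1⟩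

/-- The cover check of the row `Octic.C4C2Square` (kernel computation). -/
theorem coversFaces_octicC4C2Square : coversFaces Octic.C4C2Square.Γ Octic.C4C2Square.reps = true := by decide +kernel

/-- **Row `Octic.C4C2Square`**: every face of the model is a twist of a sealed representative. -/
theorem cover_octicC4C2Square (Φ : Finset (Elt Octic.C4C2Square.Γ)) (p p' : Elt Octic.C4C2Square.Γ)
    (hΦ : IsCMType (Elt.conj Octic.C4C2Square.Γ) Φ) (hp : p' ∉ place (Elt.conj Octic.C4C2Square.Γ) p) :
    ∃ r ∈ Octic.C4C2Square.reps, ∃ g : Elt Octic.C4C2Square.Γ,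
      GSet.faceCornersMul (Elt.conj Octic.C4C2Square.Γ) Φ p p' = (cornersMul Octic.C4C2Square.Γ r).map fun S => rmul S g :=
  cover_of_coversFaces Octic.C4C2Square.Γ Octic.C4C2Square.reps coversFaces_octicC4C2Square Φ p p' hΦ hp

/-! ### Row `Octic.C4C2Nonsquare` — the row `ℤ/4 × ℤ/2`, `c` a non-square (4 representatives) -/

/-- The group check of the row, from p4's census theorem. -/
instance factOcticC4C2Nonsquare : Fact (Octic.C4C2Nonsquare.Γ.isCMGaloisType = true) := ⟨Octic.C4C2Nonsquare.census.1⟩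

/-- The cover check of the row `Octic.C4C2Nonsquare` (kernel computation). -/
theorem coversFaces_octicC4C2Nonsquare : coversFaces Octic.C4C2Nonsquare.Γ Octic.C4C2Nonsquare.reps = true := by decide +kernel

/-- **Row `Octic.C4C2Nonsquare`**: every face of the model is a twist of a sealed representative. -/
theorem cover_octicC4C2Nonsquare (Φ : Finset (Elt Octic.C4C2Nonsquare.Γ)) (p p' : Elt Octic.C4C2Nonsquare.Γ)
    (hΦ : IsCMType (Elt.conj Octic.C4C2Nonsquare.Γ) Φ) (hp : p' ∉ place (Elt.conj Octic.C4C2Nonsquare.Γ) p) :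
    ∃ r ∈ Octic.C4C2Nonsquare.reps, ∃ g : Elt Octic.C4C2Nonsquare.Γ,
      GSet.faceCornersMul (Elt.conj Octic.C4C2Nonsquare.Γ) Φ p p' = (cornersMul Octic.C4C2Nonsquare.Γ r).map fun S => rmul S g :=
  cover_of_coversFaces Octic.C4C2Nonsquare.Γ Octic.C4C2Nonsquare.reps coversFaces_octicC4C2Nonsquare Φ p p' hΦ hp

/-! ### Row `Octic.Triquadratic` — the triquadratic row (6 representatives) -/

/-- The group check of the row, from p4's census theorem. -/
instance factOcticTriquadratic : Fact (Octic.Triquadratic.Γ.isCMGaloisType = true) := ⟨Octic.Triquadratic.census.1⟩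

/-- The cover check of the row `Octic.Triquadratic` (kernel computation). -/
theorem coversFaces_octicTriquadratic : coversFaces Octic.Triquadratic.Γ Octic.Triquadratic.reps = true := by decide +kernel

/-- **Row `Octic.Triquadratic`**: every face of the model is a twist of a sealed representative. -/
theorem cover_octicTriquadratic (Φ : Finset (Elt Octic.Triquadratic.Γ)) (p p' : Elt Octic.Triquadratic.Γ)
    (hΦ : IsCMType (Elt.conj Octic.Triquadratic.Γ) Φ) (hp : p' ∉ place (Elt.conj Octic.Triquadratic.Γ) p) :
    ∃ r ∈ Octic.Triquadratic.reps, ∃ g : Elt Octic.Triquadratic.Γ,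
      GSet.faceCornersMul (Elt.conj Octic.Triquadratic.Γ) Φ p p' = (cornersMul Octic.Triquadratic.Γ r).map fun S => rmul S g :=
  cover_of_coversFaces Octic.Triquadratic.Γ Octic.Triquadratic.reps coversFaces_octicTriquadratic Φ p p' hΦ hp

/-! ### Row `Octic.Dihedral` — the dihedral octic row (5 representatives) -/

/-- The group check of the row, from p4's census theorem. -/
instance factOcticDihedral : Fact (Octic.Dihedral.Γ.isCMGaloisType = true) := ⟨Octic.Dihedral.census.1⟩

/-- The cover check of the row `Octic.Dihedral` (kernel computation). -/
theorem coversFaces_octicDihedral : coversFaces Octic.Dihedral.Γ Octic.Dihedral.reps = true := by decide +kernel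

/-- **Row `Octic.Dihedral`**: every face of the model is a twist of a sealed representative. -/
theorem cover_octicDihedral (Φ : Finset (Elt Octic.Dihedral.Γ)) (p p' : Elt Octic.Dihedral.Γ)
    (hΦ : IsCMType (Elt.conj Octic.Dihedral.Γ) Φ) (hp : p' ∉ place (Elt.conj Octic.Dihedral.Γ) p) :
    ∃ r ∈ Octic.Dihedral.reps, ∃ g : Elt Octic.Dihedral.Γ,
      GSet.faceCornersMul (Elt.conj Octic.Dihedral.Γ) Φ p p' = (cornersMul Octic.Dihedral.Γ r).map fun S => rmul S g :=
  cover_of_coversFaces Octic.Dihedral.Γ Octic.Dihedral.reps coversFaces_octicDihedral Φ p p' hΦ hp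

/-! ### Row `Octic.Quaternion` — the quaternion row (3 representatives) -/

/-- The group check of the row, from p4's census theorem. -/
instance factOcticQuaternion : Fact (Octic.Quaternion.Γ.isCMGaloisType = true) := ⟨Octic.Quaternion.census.1⟩

/-- The cover check of the row `Octic.Quaternion` (kernel computation). -/
theorem coversFaces_octicQuaternion : coversFaces Octic.Quaternion.Γ Octic.Quaternion.reps = true := by decide +kernel

/-- **Row `Octic.Quaternion`**: every face of the model is a twist of a sealed representative. -/
theorem cover_octicQuaternion (Φ : Finset (Elt Octic.Quaternion.Γ)) (p p' : Elt Octic.Quaternion.Γ)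
    (hΦ : IsCMType (Elt.conj Octic.Quaternion.Γ) Φ) (hp : p' ∉ place (Elt.conj Octic.Quaternion.Γ) p) :
    ∃ r ∈ Octic.Quaternion.reps, ∃ g : Elt Octic.Quaternion.Γ,
      GSet.faceCornersMul (Elt.conj Octic.Quaternion.Γ) Φ p p' = (cornersMul Octic.Quaternion.Γ r).map fun S => rmul S g :=
  cover_of_coversFaces Octic.Quaternion.Γ Octic.Quaternion.reps coversFaces_octicQuaternion Φ p p' hΦ hp

end HodgeRepro.Night3.Census
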